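import Summits.QuantumFields.YangMills.Theorems.UnitScaleTiltProp7DeltaEtaHfCompositeNorm
import Summits.QuantumFields.YangMills.Theorems.UnitScaleTiltProp7GreenPiBlockDecayOfLetters
import HarnessLib

/-!
# Route `UnitScaleTilt`, crux K1 «MinimiserStabilityRegPr» (stmt-QuantumFields-19200), EX face S47 — ROW (4) `h88`: **THE h88-DOOR.  THE POINTWISE DECAY ROW OF
# `Δ^η H_π` FROM THE ROWS `h137kπ` ∧ `h133` AND ONE AGMON-WEIGHTED GRADIENT ROW (c4w) OF `R_S G′ᴾ`** — print [Balaban1985Variational] (88)∕(137)–(138) «`Δ^ηHB = Q*(QGQ*)⁻¹B − Q*aB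
# + (DG′RD*)ᵀΔ^ηHB`» read bondwise with [Balaban1985BackgroundPropagators] (3.117)'s LOCAL current pairing (★p1 g28 CHAIR LOCATE №41: `h88` is NOT in the Hölder class).

Cell `ym3-torus` (HUMAN RULING D-0037; rung R3 = SU(2) YM₃ on T³ — NOT d = 4, NOT infinite volume, NOT a mass gap, NOT Clay).  Fleet lead ∕ chair seat `ym-ust-19200-p1` (gen 28).
THEOREMS ONLY (0 `def`, 0 `sorry`); `--supports stmt-QuantumFields-19200 --as helper`; count-neutral.

THE MATHEMATICS.  On the class `PosOnto …(DeltaPiSlotP a) U₀`, for a block datum `X` and the route reading `X′ = ι(H̃ᴾ X) = toL2⁻¹(H_π(toL2B X))` of the (115)-reader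
`H̃ᴾ = H1f …(DeltaPiSlotP a) U₀`: (3.26) + `Q_kH = 1` + `R_SD*H = 0` give (137) `Δ_πᴾ(toL2 X′) = Q_k†(K_π⁻¹B̃) − Q_k†(a•B̃)` (✓`Prop7DeltaEtaHfCompositeNorm.DeltaPiSlotP_toL2_iota_H1f_eq`),
and FILE C's two words of the perturbation (✓`Prop7GreenPiSupRowsOfLetters.DeltaPiP_sub_DeltaEta_apply`: `Δ_πᴾu − Δ^ηu = −Δ^η(DG′ᴾR_SD*u) − DR_SG′ᴾD*Δ^η(Pᴾu)`) collapse on a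
Landau field (`R_SD*u = 0` ⇒ `Pᴾu = u`) to **`Δ^ηu = Δ_πᴾu + D(R_S(G′ᴾ(D*Δ^ηu)))`**.  The `(−3)`-size of the current `Δ̃^η(H̃ᴾ X)` IS the bond value `toL2⁻¹(Δ^η(toL2 X′))`
(✓`equiv_currentCLM_slot` — the `nabla115` in the TYPE never acts: `h88` is a VALUE row).  Hence POINTWISE at each fine bond: `|Δ^ηH_πδ_yZ|(b) ≤ [ROW h137kπ](b) + |D R_S G′ᴾ j|(b)`,
`j := D*Δ^η(H_πδ_yZ)`; the source `j` is `O(α)` AND DECAYS from `ŷ` with NO `η`-loss (✓D1 `Prop7GreenPiBlockDecayLocal.DstarL2_DeltaEta_decay`: (3.117) is local, `‖J₁‖ ≤ αη³` against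
`c₀η⁻³`) once `H_πδ_yZ` decays (ROW `h133`); the Agmon-weighted gradient row (c4w) of `R_S G′ᴾ` — the ORDER-SWAPPED twin of px5's (c2w) `DG′ᴾR_S` (✓`Prop7GaugeProjectorBlockPackage.hc2w_of_letters`),
i.e. the weighted edition of the hPcol storey's `hrow` (✓`Prop7PcolOfGradientRow.gradient_row_of_letters` = its rate-0 case) — finishes: `CΔ = CK + 6α(1+e^{4δ})·C₄·CH` at the common rate `δ`.

WHAT IS PROVED (ns `…Theorems.Prop7H88DoorOfH137H133`; member `F n K`, `h : n ≤ K`, weights `c₀ cB > 0`, coupling `0 ≤ a`).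
* §1 ★ `DeltaEta_eq_DeltaPiP_add_of_landau` — `R_S(D*u) = 0 → Δ^ηu = Δ_πᴾu + D(R_S(G′ᴾ(D*(Δ^ηu))))` (every `u`); ★ `DeltaEta_toL2_iota_H1f_eq` — for `u = toL2 X′`:
  `Δ^η(toL2 X′) = [Q_k†(K_π⁻¹B̃) − Q_k†(a•B̃)] + D(R_S(G′ᴾ(D*Δ^η(toL2 X′))))`.
* §2 ★★★ **`h88_of_h137k_h133_c4w`** — MEMBER: `RegPr F n K α U₀`, `0 ≤ a`, `PosOnto(Π)`, the three letters `h137k` (S47's `h137kπ` member text), `h133` (S47's `h133` member text) and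
  `hc4w` at ONE rate `δ ≥ 0` ⟹ S47's `h88` member text with `CΔ := CK + 6α(1+e^{4δ})·C₄·CH`, rate `δ`.
* §3 ★★★ **`h88_family_of_h137k_h133_c4w`** — Idx EDITION under ANY thread `Λ L i U₀` (S47: the Lift antecedent): S47's `h137kπ`∕`h133` binder texts VERBATIM (rates `δKπ L`, `δH L∕2`),
  the (c4w)-family at a rate `δ₄ L ≤ min(δKπ L, δH L∕2)`, `PosOnto(Π)` under the thread ⟹ S47's `h88` binder text VERBATIM with `CΔ L := CKπ L + 6·α L·(1+e^{4δ₄ L})·C₄ L·CH L`, `δΔ := δ₄`.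
HYP-SAT (★★OWNER RULING №42).  `h137k`∕`h133` are the EX display's own rows (suppliers: ✓`Prop7PiSlotRowsOfCone.kernel137_pi_family_of_blockLetters`, ✓`Prop7Kernel133OfPiBlockLetters`);
`hc4w` is a real-inequality schema over ALL decaying site sources (tested at `v = 0` it forces only `0 ≤ C₄·m`; non-vacuous, no `Prop` placeholder), located supplier road: ✓Z4
`RS_GprimeP_eq_RS_G` ∘ ✓P4 `RS_G_eq_of_sourceForm` ∘ {✓W4 `hDw`, ✓W1 `hGw`, (src-κ)}; `PosOnto(Π)` ⟸ ✓`hco_DeltaPiSlotP_exists` + ✓`posOnto_of_coercive`.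
HONEST SCOPE.  Algebra + two triangle inequalities over landed identities; CONDITIONAL on the three displayed letters; nothing of (c4w), `h137kπ`, `h133`, the other EX rows, `hThm2S`,
EX `stub_existenceMinimalOrbit` or the crux is proved here; nothing continuum ∕ OS ∕ mass-gap ∕ Clay.

References: T. Bałaban, CMP **102** (1985) 277–309 [Balaban1985Variational] ((88) p.291, (137)–(139) pp.298–299, (45)–(46) p.285, (115) p.294); CMP **99** (1985) 389–434
[Balaban1985BackgroundPropagators] ((3.26) p.395, (3.117)–(3.120) p.419, (3.124)–(3.126) p.420, (3.133) p.422, Thm 3.12 p.423).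
-/

set_option autoImplicit false

noncomputable section

open scoped InnerProductSpace ComplexConjugate Matrix.Norms.L2Operator BigOperators

namespace Summit.QuantumFields.YangMills.Theorems.Prop7H88DoorOfH137H133

open Literature.MathematicalPhysics.QuantumFieldTheory.Balaban1983to89
open Literature.MathematicalPhysics.QuantumFieldTheory.Balaban1983to89.T3ContinuumYM3Torus
open Literature.MathematicalPhysics.QuantumFieldTheory.Balaban1983to89.T3Thm1Carrier (Idx)
open Literature.MathematicalPhysics.QuantumFieldTheory.Balaban1983to89.T3PrintedRegularMinimiser (RegPr)
open Literature.MathematicalPhysics.QuantumFieldTheory.Balaban1983to89.B9Eq3119DeltaPiCarrier (currentCLM)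
open T3PrintedMinimiserExistence (regPr_mono)
open T3PrintedRegularOrbits (sites_eq)
open T3LevelShift (siteShift)
open T3SectALandauChart (eta eta_pos)
open B5Eq118OneStroke (iterBlockOf)
open B9SectCLatticeCarrier (Bond)
open B9Eq311L2Pairing (WL2)
open B11Eq103H1Complex (SiteL2K BondL2K)
open B11Eq115Space (NegSize Space115 JetSup NegSup levWeight)
open B11Eq111FrakG (nabla115)
open B11Eq90V0primeCurrent (flat115 flat115_apply)
open Summit.QuantumFields.YangMills.Theorems.Prop7SectET3Transport (periodsT3 bondEquiv bgOfCfg)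
open Summit.QuantumFields.YangMills.Theorems.Prop7SectET3HilbertLetters (W₂ frobEquiv toL2 toL2S toL2B DL2 DstarL2)
open Summit.QuantumFields.YangMills.Theorems.Prop7SectET3GaugeProjector (NS RS)
open Summit.QuantumFields.YangMills.Theorems.Prop7SectET3WilsonHessian (DeltaEta DeltaEtaSlot DeltaEtaSlot_apply)
open Summit.QuantumFields.YangMills.Theorems.Prop7SectET3CurvedPropagators (Qk GT KinvT HT H1f PosOnto)
open Summit.QuantumFields.YangMills.Theorems.Prop7SectET3DeltaPiPInv (GprimeP gaugeCorrP DeltaPiP DeltaPiSlotP gaugeCorrP_apply DeltaPiSlotP_apply)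
open Summit.QuantumFields.YangMills.Theorems.Prop7GreenPiSupRowsOfLetters (DeltaPiP_sub_DeltaEta_apply)
open Summit.QuantumFields.YangMills.Theorems.Prop7GreenPiBlockDecayLocal (DstarL2_DeltaEta_decay)
open Summit.QuantumFields.YangMills.Theorems.Prop7DeltaPiDefectPairing (norm_J_one_le_of_regPr)
open Summit.QuantumFields.YangMills.Theorems.Prop7DeltaEtaHfCompositeNorm (DeltaPiSlotP_toL2_iota_H1f_eq landau_iota_H1f)
open Summit.QuantumFields.YangMills.Theorems.Prop7SectET3SlotCurrentRows (equiv_currentCLM_slot)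

variable {F : T3Family} {n K : ℕ} {h : n ≤ K} {c₀ cB a : ℝ} [Fact (0 < c₀)] [Fact (0 < cB)]

/-! ## §1 (138) on a Landau field: `Δ^ηu = Δ_πᴾu + D R_S G′ᴾ D*Δ^ηu` -/

/-- ★ **(138) ON A LANDAU FIELD**: if `R_S(D*_{U₀}u) = 0` then `Δ^ηu = Δ_πᴾu + D(R_S(G′ᴾ(D*(Δ^ηu))))` — FILE C's two words of `Δ_πᴾu − Δ^ηu` (✓`DeltaPiP_sub_DeltaEta_apply`) with
`λ₁ = G′ᴾ(R_S(D*u)) = 0` and `Pᴾu = u`. [cite: Balaban1985Variational, (138) p.299; Balaban1985BackgroundPropagators, (3.119)–(3.120) p.419] -/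
theorem DeltaEta_eq_DeltaPiP_add_of_landau (ha : 0 ≤ a) (U₀ : GaugeField (F.P K) 0 (Matrix.specialUnitaryGroup (Fin 2) ℂ)) (u : BondL2K ℂ 3 (periodsT3 F K) c₀ W₂)
    (hland : RS F n K h c₀ cB U₀ (DstarL2 F n K c₀ U₀ u) = 0) :
    DeltaEta F n K c₀ U₀ u
      = DeltaPiP F n K h c₀ cB a U₀ u + DL2 F n K c₀ U₀ (RS F n K h c₀ cB U₀ (GprimeP F n K h c₀ cB a U₀ (DstarL2 F n K c₀ U₀ (DeltaEta F n K c₀ U₀ u)))) := by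
  have hP : gaugeCorrP F n K h c₀ cB a U₀ u = u := by
    rw [gaugeCorrP_apply, hland, map_zero, map_zero, sub_zero]
  have h2 := DeltaPiP_sub_DeltaEta_apply (h := h) (cB := cB) ha U₀ u
  rw [hland, map_zero, map_zero, map_zero, neg_zero, zero_sub, hP] at h2
  -- `Δ_πᴾu − Δ^ηu = −D(R_S(G′ᴾ(D*Δ^ηu)))`
  have h4 : DeltaEta F n K c₀ U₀ u - DeltaPiP F n K h c₀ cB a U₀ u
      = DL2 F n K c₀ U₀ (RS F n K h c₀ cB U₀ (GprimeP F n K h c₀ cB a U₀ (DstarL2 F n K c₀ U₀ (DeltaEta F n K c₀ U₀ u)))) := by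
    rw [← neg_sub, h2, neg_neg]
  exact sub_eq_iff_eq_add'.1 h4

/-- ★ **(137)–(138) FOR THE READER OF RECORD, BONDWISE-READY**: on the class, for `X′ = ι(H̃ᴾ X)`,
`Δ^η(toL2 X′) = [Q_k†(K_π⁻¹ toL2B X) − Q_k†(a • toL2B X)] + D(R_S(G′ᴾ(D*(Δ^η(toL2 X′)))))`. [cite: Balaban1985Variational, (88) p.291, (137)–(138) pp.298–299] -/
theorem DeltaEta_toL2_iota_H1f_eq [Fact (0 < (F.L : ℝ))] [Fact (0 < ((F.L : ℝ)⁻¹) ^ (K - n))] (ha : 0 ≤ a)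
    {U₀ : GaugeField (F.P K) 0 (Matrix.specialUnitaryGroup (Fin 2) ℂ)} (hp : PosOnto F n K h c₀ cB a (DeltaPiSlotP F n K h c₀ cB a) U₀)
    (X : PBond (F.P n) 0 → Matrix (Fin 2) (Fin 2) ℂ) :
    DeltaEta F n K c₀ U₀ (toL2 F K c₀ (fun b : PBond (F.P K) 0 => JetSup.equiv _ _ _ (H1f F n K h c₀ cB a (DeltaPiSlotP F n K h c₀ cB a) U₀ X) (bondEquiv F K b)))
      = (LinearMap.adjoint (Qk F n K h c₀ cB U₀) (KinvT F n K h c₀ cB a (DeltaPiSlotP F n K h c₀ cB a) U₀ (toL2B F n cB X))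
          - LinearMap.adjoint (Qk F n K h c₀ cB U₀) (((a : ℂ)) • toL2B F n cB X))
        + DL2 F n K c₀ U₀ (RS F n K h c₀ cB U₀ (GprimeP F n K h c₀ cB a U₀ (DstarL2 F n K c₀ U₀ (DeltaEta F n K c₀ U₀
            (toL2 F K c₀ (fun b : PBond (F.P K) 0 => JetSup.equiv _ _ _ (H1f F n K h c₀ cB a (DeltaPiSlotP F n K h c₀ cB a) U₀ X) (bondEquiv F K b))))))) := by
  conv_lhs => rw [DeltaEta_eq_DeltaPiP_add_of_landau (h := h) (cB := cB) ha U₀ _ (landau_iota_H1f ha hp X)]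
  rw [← DeltaPiSlotP_apply, DeltaPiSlotP_toL2_iota_H1f_eq ha hp X]

/-! ## §2 ★★★ The member door -/

/-- ★★★ **h88-DOOR, MEMBER**: on `RegPr F n K α U₀`, `0 ≤ a`, the class `PosOnto …(DeltaPiSlotP a) U₀`, and three letters at one rate `δ ≥ 0` — the (137) kernel row `h137k` (S47's `h137kπ`
member text), the (3.133) kernel row `h133` (S47's `h133` member text, here at rate `δ`), and the Agmon-weighted gradient row `hc4w` of `R_S G′ᴾ` — THE S47 ROW TEXT OF `h88` AT THE MEMBER:
`‖(Δ̃^η(H̃ᴾ(δ_y ⊗ Z)))(b′)‖ ≤ (CK + 6α(1+e^{4δ})·C₄·CH)·e^{−δ·tdist(B((bondEquiv)⁻¹b′), ŷ)}·‖Z‖`.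
[cite: Balaban1985Variational, (88) p.291, (137)–(138) pp.298–299; Balaban1985BackgroundPropagators, (3.117) p.419, (3.133) p.422, Thm 3.12 p.423] -/
theorem h88_of_h137k_h133_c4w [Fact (0 < (F.L : ℝ))] [Fact (0 < ((F.L : ℝ)⁻¹) ^ (K - n))] {α : ℝ} (ha : 0 ≤ a)
    (U₀ : GaugeField (F.P K) 0 (Matrix.specialUnitaryGroup (Fin 2) ℂ)) (hreg : RegPr F n K α U₀) (hp : PosOnto F n K h c₀ cB a (DeltaPiSlotP F n K h c₀ cB a) U₀)
    {CK CH C₄ δ : ℝ} (hδ : 0 ≤ δ) (hCH : 0 ≤ CH)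
    (h137k : ∀ (y : PBond (F.P n) 0) (Z : Matrix (Fin 2) (Fin 2) ℂ) (b : PBond (F.P K) 0),
      ‖(toL2 F K c₀).symm (LinearMap.adjoint (Qk F n K h c₀ cB U₀) (KinvT F n K h c₀ cB a (DeltaPiSlotP F n K h c₀ cB a) U₀ (toL2B F n cB (Pi.single y Z)))
          - LinearMap.adjoint (Qk F n K h c₀ cB U₀) (((a : ℂ)) • toL2B F n cB (Pi.single y Z))) b‖
        ≤ CK * Real.exp (-(δ * (Site.tdist (P := F.P K) (iterBlockOf (K - n) b.src) (siteShift (sites_eq F n K h) y.src) : ℝ))) * ‖Z‖)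
    (h133 : ∀ (y : PBond (F.P n) 0) (Z : Matrix (Fin 2) (Fin 2) ℂ) (b' : Bond 3 (periodsT3 F K)),
      ‖flat115 (H1f F n K h c₀ cB a (DeltaPiSlotP F n K h c₀ cB a) U₀ (Pi.single y Z)) b'‖
        ≤ CH * Real.exp (-(δ * (Site.tdist (P := F.P K) (iterBlockOf (K - n) ((bondEquiv F K).symm b').src) (siteShift (sites_eq F n K h) y.src) : ℝ))) * ‖Z‖)
    (hc4w : ∀ (z : Site (F.P K) (K - n)) (v : Site (F.P K) 0 → Matrix (Fin 2) (Fin 2) ℂ) (m : ℝ), 0 ≤ m →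
      (∀ x, ‖v x‖ ≤ m * Real.exp (-(δ * (Site.tdist (P := F.P K) (iterBlockOf (K - n) x) z : ℝ)))) →
      ∀ b : PBond (F.P K) 0, ‖(toL2 F K c₀).symm (DL2 F n K c₀ U₀ (RS F n K h c₀ cB U₀ (GprimeP F n K h c₀ cB a U₀ (toL2S F K c₀ v)))) b‖
        ≤ C₄ * m * Real.exp (-(δ * (Site.tdist (P := F.P K) (iterBlockOf (K - n) b.src) z : ℝ))))
    (y : PBond (F.P n) 0) (Z : Matrix (Fin 2) (Fin 2) ℂ) (b' : Bond 3 (periodsT3 F K)) :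
    ‖NegSup.equiv (levWeight (F.L : ℝ) (((F.L : ℝ)⁻¹) ^ (K - n)) (fun _ : Bond 3 (periodsT3 F K) => K - n) 3) (Matrix (Fin 2) (Fin 2) ℂ)
        ((currentCLM frobEquiv (fun _ : Bond 3 (periodsT3 F K) × Fin 3 => K - n) (nabla115 (((F.L : ℝ)⁻¹) ^ (K - n)) (bgOfCfg F K U₀)) (DeltaEtaSlot F n K c₀ U₀))
          ((H1f F n K h c₀ cB a (DeltaPiSlotP F n K h c₀ cB a) U₀) (Pi.single y Z))) b'‖
      ≤ (CK + 6 * α * (1 + Real.exp (4 * δ)) * C₄ * CH)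
          * Real.exp (-(δ * (Site.tdist (P := F.P K) (iterBlockOf (K - n) ((bondEquiv F K).symm b').src) (siteShift (sites_eq F n K h) y.src) : ℝ))) * ‖Z‖ := by
  -- the route reading `X′ = ι(H̃ᴾ(δ_y ⊗ Z))` (opaque name), its decay from `h133`
  obtain ⟨X', hX'⟩ : ∃ X' : PBond (F.P K) 0 → Matrix (Fin 2) (Fin 2) ℂ,
      X' = fun b : PBond (F.P K) 0 => JetSup.equiv _ _ _ (H1f F n K h c₀ cB a (DeltaPiSlotP F n K h c₀ cB a) U₀ (Pi.single y Z)) (bondEquiv F K b) := ⟨_, rfl⟩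
  have hXb : ∀ b : PBond (F.P K) 0, X' b = JetSup.equiv _ _ _ (H1f F n K h c₀ cB a (DeltaPiSlotP F n K h c₀ cB a) U₀ (Pi.single y Z)) (bondEquiv F K b) :=
    fun b => by rw [hX']
  have hXdec : ∀ b : PBond (F.P K) 0,
      ‖X' b‖ ≤ CH * ‖Z‖ * Real.exp (-(δ * (Site.tdist (P := F.P K) (iterBlockOf (K - n) b.src) (siteShift (sites_eq F n K h) y.src) : ℝ))) := by
    intro b
    have h1 := h133 y Z (bondEquiv F K b)
    rw [flat115_apply, Equiv.symm_apply_apply] at h1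
    rw [hXb]
    calc _ ≤ CH * Real.exp (-(δ * (Site.tdist (P := F.P K) (iterBlockOf (K - n) b.src) (siteShift (sites_eq F n K h) y.src) : ℝ))) * ‖Z‖ := h1
      _ = _ := by ring
  -- the source `j = D*Δ^η(toL2 X′)` decays (D1: (3.117) is local)
  have hm0 : 0 ≤ CH * ‖Z‖ := mul_nonneg hCH (norm_nonneg _)
  have hj : ∀ x : Site (F.P K) 0, ‖(toL2S F K c₀).symm (DstarL2 F n K c₀ U₀ (DeltaEta F n K c₀ U₀ (toL2 F K c₀ X'))) x‖
      ≤ (6 * α * (1 + Real.exp (4 * δ)) * (CH * ‖Z‖)) * Real.exp (-(δ * (Site.tdist (P := F.P K) (iterBlockOf (K - n) x) (siteShift (sites_eq F n K h) y.src) : ℝ))) :=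
    fun x => DstarL2_DeltaEta_decay hδ U₀ hreg X' (siteShift (sites_eq F n K h) y.src) hm0 hXdec x
  -- `α ≥ 0` from the regularity class (as in D1)
  have hη : 0 < eta F n K := eta_pos F n K
  have hα : 0 ≤ α := by
    have hJ := norm_J_one_le_of_regPr U₀ hreg 0 (Classical.arbitrary _)
    have h0 : 0 * eta F n K ^ 3 ≤ α * eta F n K ^ 3 := by rw [zero_mul]; exact (norm_nonneg _).trans hJ
    exact le_of_mul_le_mul_right h0 (pow_pos hη 3)
  have hm1 : 0 ≤ 6 * α * (1 + Real.exp (4 * δ)) * (CH * ‖Z‖) := by positivity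
  -- (c4w) on the source `v := toL2S⁻¹ j`
  have hX : ∀ b : PBond (F.P K) 0,
      ‖(toL2 F K c₀).symm (DL2 F n K c₀ U₀ (RS F n K h c₀ cB U₀ (GprimeP F n K h c₀ cB a U₀
          (DstarL2 F n K c₀ U₀ (DeltaEta F n K c₀ U₀ (toL2 F K c₀ X')))))) b‖
        ≤ C₄ * (6 * α * (1 + Real.exp (4 * δ)) * (CH * ‖Z‖))
            * Real.exp (-(δ * (Site.tdist (P := F.P K) (iterBlockOf (K - n) b.src) (siteShift (sites_eq F n K h) y.src) : ℝ))) := by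
    intro b
    have h4 := hc4w (siteShift (sites_eq F n K h) y.src) ((toL2S F K c₀).symm (DstarL2 F n K c₀ U₀ (DeltaEta F n K c₀ U₀ (toL2 F K c₀ X')))) _ hm1 hj b
    rw [LinearEquiv.apply_symm_apply] at h4
    exact h4
  -- the reading and the split
  rw [equiv_currentCLM_slot, DeltaEtaSlot_apply, DeltaEta_toL2_iota_H1f_eq ha hp (Pi.single y Z), ← hX', map_add, Pi.add_apply]
  refine (norm_add_le _ _).trans ?_
  have h1 := h137k y Z ((bondEquiv F K).symm b')
  have h2 := hX ((bondEquiv F K).symm b')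
  calc _ ≤ CK * Real.exp (-(δ * (Site.tdist (P := F.P K) (iterBlockOf (K - n) ((bondEquiv F K).symm b').src) (siteShift (sites_eq F n K h) y.src) : ℝ))) * ‖Z‖
        + C₄ * (6 * α * (1 + Real.exp (4 * δ)) * (CH * ‖Z‖))
            * Real.exp (-(δ * (Site.tdist (P := F.P K) (iterBlockOf (K - n) ((bondEquiv F K).symm b').src) (siteShift (sites_eq F n K h) y.src) : ℝ))) :=
      add_le_add h1 h2
    _ = _ := by ring

/-! ## §3 ★★★ The Idx edition in the EX display's `h88` text -/

section Family

/-- Rate monotonicity of a kernel bound: `C·e^{−δ₁·d}·n ≤ C·e^{−δ·d}·n` for `0 ≤ δ ≤ δ₁`, `0 ≤ d`, `0 ≤ C`, `0 ≤ n`. [cite: Balaban1985BackgroundPropagators, Thm 3.12 p.423] -/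
theorem kernelBound_mono_rate {C δ δ₁ d nZ : ℝ} (hC : 0 ≤ C) (hn : 0 ≤ nZ) (hd : 0 ≤ d) (hδδ : δ ≤ δ₁) :
    C * Real.exp (-(δ₁ * d)) * nZ ≤ C * Real.exp (-(δ * d)) * nZ := by
  have he : Real.exp (-(δ₁ * d)) ≤ Real.exp (-(δ * d)) := Real.exp_le_exp.2 (by nlinarith)
  exact mul_le_mul_of_nonneg_right (mul_le_mul_of_nonneg_left he hC) hn

/-- ★★★ **h88-DOOR, Idx EDITION**: for a cap `α`, L-only weights, a member coupling `0 ≤ a L i`, ANY thread `Λ L i U₀` (S47: the Lift antecedent), the class `PosOnto(Π)` displayed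
under the thread, S47's ROW TEXTS `h137kπ` (rate `δKπ`) and `h133` (rate `δH∕2`) VERBATIM under the thread, and the (c4w)-family at a rate `0 ≤ δ₄ L ≤ min(δKπ L, δH L∕2)` — THE S47 ROW TEXT OF
`h88` under the same thread, `CΔ L := CKπ L + 6·α L·(1 + e^{4δ₄ L})·C₄ L·CH L`, `δΔ := δ₄`.
[cite: Balaban1985Variational, (88) p.291, (137)–(138) pp.298–299; Balaban1985BackgroundPropagators, (3.117) p.419, (3.133) p.422, Thm 3.12 p.423] -/
theorem h88_family_of_h137k_h133_c4w
    [hFL : ∀ F : T3Family, Fact (0 < (F.L : ℝ))] [hFη : ∀ (F : T3Family) (k : ℕ), Fact (0 < ((F.L : ℝ)⁻¹) ^ k)]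
    (α : ℕ → ℝ)
    (c₀ cB : ℕ → ℝ) [hc₀ : ∀ L : ℕ, Fact (0 < c₀ L)] [hcB : ∀ L : ℕ, Fact (0 < cB L)] (a : ∀ L : ℕ, Idx L → ℝ) (ha : ∀ (L : ℕ) (i : Idx L), 0 ≤ a L i)
    (Λ : ∀ (L : ℕ) (i : Idx L), GaugeField (i.1.1.P i.1.2.2) 0 (Matrix.specialUnitaryGroup (Fin 2) ℂ) → Prop)
    (hpos : ∀ (L : ℕ), 1 < L → ∀ (i : Idx L) (U₀ : GaugeField (i.1.1.P i.1.2.2) 0 (Matrix.specialUnitaryGroup (Fin 2) ℂ)), ∀ ρ : ℝ, RegPr i.1.1 i.1.2.1 i.1.2.2 ρ U₀ → ρ ≤ α L →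
      Λ L i U₀ → PosOnto i.1.1 i.1.2.1 i.1.2.2 i.2.2.le (c₀ L) (cB L) (a L i) (DeltaPiSlotP i.1.1 i.1.2.1 i.1.2.2 i.2.2.le (c₀ L) (cB L) (a L i)) U₀)
    (CKπ δKπ CH δH C₄ δ₄ : ℕ → ℝ) (hCKπ : ∀ L, 1 < L → 0 ≤ CKπ L) (hCH : ∀ L, 1 < L → 0 ≤ CH L)
    (hδ₄ : ∀ L, 1 < L → 0 ≤ δ₄ L) (hδ₄K : ∀ L, 1 < L → δ₄ L ≤ δKπ L) (hδ₄H : ∀ L, 1 < L → δ₄ L ≤ δH L / 2)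
    (h137kπ : ∀ (L : ℕ), 1 < L → ∀ (i : Idx L) (U₀ : GaugeField (i.1.1.P i.1.2.2) 0 (Matrix.specialUnitaryGroup (Fin 2) ℂ)), ∀ ρ : ℝ, RegPr i.1.1 i.1.2.1 i.1.2.2 ρ U₀ → ρ ≤ α L →
      Λ L i U₀ → ∀ (y : PBond (i.1.1.P i.1.2.1) 0) (Z : Matrix (Fin 2) (Fin 2) ℂ) (b : PBond (i.1.1.P i.1.2.2) 0),
        ‖(toL2 i.1.1 i.1.2.2 (c₀ L)).symm (LinearMap.adjoint (Qk i.1.1 i.1.2.1 i.1.2.2 i.2.2.le (c₀ L) (cB L) U₀) (KinvT i.1.1 i.1.2.1 i.1.2.2 i.2.2.le (c₀ L) (cB L) (a L i) (DeltaPiSlotP i.1.1 i.1.2.1 i.1.2.2 i.2.2.le (c₀ L) (cB L) (a L i)) U₀ (toL2B i.1.1 i.1.2.1 (cB L) (Pi.single y Z)))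
            - LinearMap.adjoint (Qk i.1.1 i.1.2.1 i.1.2.2 i.2.2.le (c₀ L) (cB L) U₀) (((a L i : ℂ)) • toL2B i.1.1 i.1.2.1 (cB L) (Pi.single y Z))) b‖
          ≤ CKπ L * Real.exp (-(δKπ L * (Site.tdist (iterBlockOf (i.1.2.2 - i.1.2.1) b.src) (siteShift (sites_eq i.1.1 i.1.2.1 i.1.2.2 i.2.2.le) y.src) : ℝ))) * ‖Z‖)
    (h133 : ∀ (L : ℕ), 1 < L → ∀ (i : Idx L) (U₀ : GaugeField (i.1.1.P i.1.2.2) 0 (Matrix.specialUnitaryGroup (Fin 2) ℂ)), ∀ ρ : ℝ, RegPr i.1.1 i.1.2.1 i.1.2.2 ρ U₀ → ρ ≤ α L →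
      Λ L i U₀ → ∀ (y : PBond (i.1.1.P i.1.2.1) 0) (Z : Matrix (Fin 2) (Fin 2) ℂ) (b' : Bond 3 (periodsT3 i.1.1 i.1.2.2)),
        ‖flat115 ((H1f i.1.1 i.1.2.1 i.1.2.2 i.2.2.le (c₀ L) (cB L) (a L i) (DeltaPiSlotP i.1.1 i.1.2.1 i.1.2.2 i.2.2.le (c₀ L) (cB L) (a L i)) U₀) (Pi.single y Z)) b'‖
          ≤ CH L * Real.exp (-(δH L / 2 * (Site.tdist (B5Eq118OneStroke.iterBlockOf (i.1.2.2 - i.1.2.1) ((bondEquiv i.1.1 i.1.2.2).symm b').src) (T3LevelShift.siteShift (T3PrintedRegularOrbits.sites_eq i.1.1 i.1.2.1 i.1.2.2 i.2.2.le) y.src) : ℝ))) * ‖Z‖)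
    (hc4w : ∀ (L : ℕ), 1 < L → ∀ (i : Idx L) (U₀ : GaugeField (i.1.1.P i.1.2.2) 0 (Matrix.specialUnitaryGroup (Fin 2) ℂ)), ∀ ρ : ℝ, RegPr i.1.1 i.1.2.1 i.1.2.2 ρ U₀ → ρ ≤ α L →
      Λ L i U₀ → ∀ (z : Site (i.1.1.P i.1.2.2) (i.1.2.2 - i.1.2.1)) (v : Site (i.1.1.P i.1.2.2) 0 → Matrix (Fin 2) (Fin 2) ℂ) (m : ℝ), 0 ≤ m →
        (∀ x, ‖v x‖ ≤ m * Real.exp (-(δ₄ L * (Site.tdist (iterBlockOf (i.1.2.2 - i.1.2.1) x) z : ℝ)))) →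
        ∀ b : PBond (i.1.1.P i.1.2.2) 0, ‖(toL2 i.1.1 i.1.2.2 (c₀ L)).symm (DL2 i.1.1 i.1.2.1 i.1.2.2 (c₀ L) U₀ (RS i.1.1 i.1.2.1 i.1.2.2 i.2.2.le (c₀ L) (cB L) U₀
            (GprimeP i.1.1 i.1.2.1 i.1.2.2 i.2.2.le (c₀ L) (cB L) (a L i) U₀ (toL2S i.1.1 i.1.2.2 (c₀ L) v)))) b‖
          ≤ C₄ L * m * Real.exp (-(δ₄ L * (Site.tdist (iterBlockOf (i.1.2.2 - i.1.2.1) b.src) z : ℝ)))) :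
    ∀ (L : ℕ), 1 < L → ∀ (i : Idx L) (U₀ : GaugeField (i.1.1.P i.1.2.2) 0 (Matrix.specialUnitaryGroup (Fin 2) ℂ)), ∀ ρ : ℝ, RegPr i.1.1 i.1.2.1 i.1.2.2 ρ U₀ → ρ ≤ α L →
      Λ L i U₀ → ∀ (y : PBond (i.1.1.P i.1.2.1) 0) (Z : Matrix (Fin 2) (Fin 2) ℂ) (b' : Bond 3 (periodsT3 i.1.1 i.1.2.2)),
        ‖NegSup.equiv (levWeight (i.1.1.L : ℝ) (((i.1.1.L : ℝ)⁻¹) ^ (i.1.2.2 - i.1.2.1)) (fun _ : Bond 3 (periodsT3 i.1.1 i.1.2.2) => i.1.2.2 - i.1.2.1) 3) (Matrix (Fin 2) (Fin 2) ℂ)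
            ((currentCLM frobEquiv (fun _ : Bond 3 (periodsT3 i.1.1 i.1.2.2) × Fin 3 => i.1.2.2 - i.1.2.1) (nabla115 (((i.1.1.L : ℝ)⁻¹) ^ (i.1.2.2 - i.1.2.1)) (bgOfCfg i.1.1 i.1.2.2 U₀))
              (DeltaEtaSlot i.1.1 i.1.2.1 i.1.2.2 (c₀ L) U₀)) ((H1f i.1.1 i.1.2.1 i.1.2.2 i.2.2.le (c₀ L) (cB L) (a L i) (DeltaPiSlotP i.1.1 i.1.2.1 i.1.2.2 i.2.2.le (c₀ L) (cB L) (a L i)) U₀) (Pi.single y Z))) b'‖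
          ≤ (CKπ L + 6 * α L * (1 + Real.exp (4 * δ₄ L)) * C₄ L * CH L)
              * Real.exp (-(δ₄ L * (Site.tdist (B5Eq118OneStroke.iterBlockOf (i.1.2.2 - i.1.2.1) ((bondEquiv i.1.1 i.1.2.2).symm b').src)
                  (T3LevelShift.siteShift (T3PrintedRegularOrbits.sites_eq i.1.1 i.1.2.1 i.1.2.2 i.2.2.le) y.src) : ℝ))) * ‖Z‖ := by
  intro L hL i U₀ ρ hreg hρ hl y Z b'
  haveI : Fact (0 < ((i.1.1.L : ℝ)⁻¹) ^ (i.1.2.2 - i.1.2.1)) := hFη i.1.1 _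
  have hregα : RegPr i.1.1 i.1.2.1 i.1.2.2 (α L) U₀ := regPr_mono (F := i.1.1) hρ hreg
  -- the two kernel rows at the common rate `δ₄ L` (monotonicity)
  have h137' : ∀ (y : PBond (i.1.1.P i.1.2.1) 0) (Z : Matrix (Fin 2) (Fin 2) ℂ) (b : PBond (i.1.1.P i.1.2.2) 0),
      ‖(toL2 i.1.1 i.1.2.2 (c₀ L)).symm (LinearMap.adjoint (Qk i.1.1 i.1.2.1 i.1.2.2 i.2.2.le (c₀ L) (cB L) U₀) (KinvT i.1.1 i.1.2.1 i.1.2.2 i.2.2.le (c₀ L) (cB L) (a L i) (DeltaPiSlotP i.1.1 i.1.2.1 i.1.2.2 i.2.2.le (c₀ L) (cB L) (a L i)) U₀ (toL2B i.1.1 i.1.2.1 (cB L) (Pi.single y Z)))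
          - LinearMap.adjoint (Qk i.1.1 i.1.2.1 i.1.2.2 i.2.2.le (c₀ L) (cB L) U₀) (((a L i : ℂ)) • toL2B i.1.1 i.1.2.1 (cB L) (Pi.single y Z))) b‖
        ≤ CKπ L * Real.exp (-(δ₄ L * (Site.tdist (iterBlockOf (i.1.2.2 - i.1.2.1) b.src) (siteShift (sites_eq i.1.1 i.1.2.1 i.1.2.2 i.2.2.le) y.src) : ℝ))) * ‖Z‖ :=
    fun y Z b => (h137kπ L hL i U₀ ρ hreg hρ hl y Z b).trans (kernelBound_mono_rate (hCKπ L hL) (norm_nonneg _) (Nat.cast_nonneg _) (hδ₄K L hL))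
  have h133' : ∀ (y : PBond (i.1.1.P i.1.2.1) 0) (Z : Matrix (Fin 2) (Fin 2) ℂ) (b' : Bond 3 (periodsT3 i.1.1 i.1.2.2)),
      ‖flat115 ((H1f i.1.1 i.1.2.1 i.1.2.2 i.2.2.le (c₀ L) (cB L) (a L i) (DeltaPiSlotP i.1.1 i.1.2.1 i.1.2.2 i.2.2.le (c₀ L) (cB L) (a L i)) U₀) (Pi.single y Z)) b'‖
        ≤ CH L * Real.exp (-(δ₄ L * (Site.tdist (iterBlockOf (i.1.2.2 - i.1.2.1) ((bondEquiv i.1.1 i.1.2.2).symm b').src) (siteShift (sites_eq i.1.1 i.1.2.1 i.1.2.2 i.2.2.le) y.src) : ℝ))) * ‖Z‖ :=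
    fun y Z b' => (h133 L hL i U₀ ρ hreg hρ hl y Z b').trans (kernelBound_mono_rate (hCH L hL) (norm_nonneg _) (Nat.cast_nonneg _) (hδ₄H L hL))
  have hmem := h88_of_h137k_h133_c4w (h := i.2.2.le) (ha L i) U₀ hregα (hpos L hL i U₀ ρ hreg hρ hl) (hδ₄ L hL) (hCH L hL) h137' h133'
    (hc4w L hL i U₀ ρ hreg hρ hl) y Z b'
  exact hmem

end Family

end Summit.QuantumFields.YangMills.Theorems.Prop7H88DoorOfH137H133

end
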